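import Summits.CriticalPhenomena.PercolationContinuityZ3.Theorems.PercNearOneGluingNoHeavyLowerTailPivotalBHKRow
import Summits.CriticalPhenomena.PercolationContinuityZ3.Theorems.PercNearOneGluingNoHeavyLowerTailThreePointGammaForced
import Summits.CriticalPhenomena.PercolationContinuityZ3.Theorems.PercNearOneGluingNoHeavyLowerTailCubicThreePointGluingCells
import Mathlib.Tactic.Linarith
import Mathlib.Tactic.Ring
import HarnessLib

/-!
# `NoHeavyLowerTail` (stmt-CriticalPhenomena-4575) — the pivotal refinement, III: the row dR2
# `u_a · T_a + q · (T_a + T_b + T_c) ≤ q · t`  (i.e. `u_a · T_a ≤ q · T₀`) on EVERY finite weighted graph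

Support file (prover prim-gen-kcluster gen 43; `--supports stmt-CriticalPhenomena-4575`).  No named facts, no sorries, no definitions.

Cells of `PrW D p` (terminals `a b c`, pairwise distinct): `q = P(a|b|c)`, `u_a = P(bc|a)`, `u_b = P(ac|b)`, `u_c = P(ab|c)`,
`t = P(abc) = PrW(conn a b ∩ conn a c)`, and the PIVOTAL cells `T_x = P(abc ∧ x pivotal)` = `PrW(conn x y ∩ conn x z ∩ pivEv x y z)`
(the other two terminals are disconnected once the pairs at `x` are closed); `T₀ := t − T_a − T_b − T_c` ("all joined, no terminal
pivotal"; the three pivotal cells are disjoint parts of `abc`, not re-proved here — the row is stated with `T_a + T_b + T_c`).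

**Theorem dR2 (`dualRowR2_PrW`).**  `u_a · T_a + q · (T_a + T_b + T_c) ≤ q · t`.
It is the DUAL (stars ↔ blob networks, `t ↔ q`, separating cells `S_x` ↔ pivotal cells `T_x`, `B₀ ↔ T₀`) of the refined row
R2 `u_a · s_a ≤ t · b₀` (`RefinedRowR2.r2_PrW`), and like R2 (= Harris + dual BHK at `b` and at `c`, KCLUSTER-gen32 §4) it is
Harris + the BHK row at `b` and at `c`:  Harris for the decreasing event `{a apart}` and the increasing event `{b ~ c off a}` gives
`u_a ≤ (q + u_a)(u_a + t − T_a)`, i.e. `u_a T_a + q T_a ≤ q t − u_a (u_b + u_c)` (using `Σ cells = 1`), and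
`q T_b ≤ u_a u_c`, `q T_c ≤ u_a u_b` (`PivotalBHK.bhkRow_PrW` with the roles of the terminals exchanged) finish.
Exact LP (prim-gen-kcluster gen 43, lp11.py): dR2 = this combination and nothing less (it is not in the cone without the BHK rows).
Tight on every blob network (triangle with 2-terminal networks as sides), where `q T₀ = u_a T_a` is a Segre minor.
[cite: VandenbergHaggstromKahn2005, Thm. 1.4 (p. 7)] for the BHK input; Harris in the Gladkov–Zimin kernel form `DecisionTree.ED_ED_le_ED_diag`.
-/

noncomputable section

namespace Summit.CriticalPhenomena.PercolationContinuityZ3.Theorems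

namespace PivotalBHK

open Finset MeasureTheory Literature.Probability.Percolation Literature.Probability.Percolation.DecisionTree
open Gladkov ThreePointGamma CovTauStarN ThreePointLB
open scoped Classical

variable {V : Type*} [Fintype V] [DecidableEq V]

/-! ### Harris for a decreasing and an increasing event, `PrW` form -/

section Harris

variable {ι : Type*} [DecidableEq ι] (D : Finset ι) {p : ι → ℝ} (hp0 : ∀ i, 0 ≤ p i) (hp1 : ∀ i, p i ≤ 1)
include hp0 hp1

omit [Fintype V] [DecidableEq V] in
/-- **Harris' inequality, mixed form**: a decreasing event and an increasing event are negatively correlated under the weighted cube,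
`PrW(A ∩ B) ≤ PrW(A) · PrW(B)` (from the Gladkov–Zimin diagonal kernel inequality). [folklore] -/
theorem PrW_inter_le_of_lower_upper {A B : Set (Finset ι)} (hA : IsLowerSet A) (hB : IsUpperSet B) :
    PrW D p (A ∩ B) ≤ PrW D p A * PrW D p B := by
  have h := ED_ED_le_ED_diag D hp0 hp1 (fun S T => (1 - ind A S) * ind B T) (by
    intro x y z t hxy hzt
    have h1 : ind A y ≤ ind A x := by
      by_cases hy : y ∈ A
      · rw [ind_of_mem hy, ind_of_mem (hA hxy hy)]
      · rw [ind_of_not_mem hy]; exact ind_nonneg A x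
    have h2 : ind B z ≤ ind B t := by
      by_cases hz : z ∈ B
      · rw [ind_of_mem hz, ind_of_mem (hB hzt hz)]
      · rw [ind_of_not_mem hz]; exact ind_nonneg B t
    nlinarith [h1, h2])
  have e1 : (fun S => ED D p (fun T => (1 - ind A S) * ind B T)) = fun S => PrW D p B * (1 - ind A S) := by
    funext S; rw [ED_mul_left, mul_comm, PrW_eq_sum_ind]; rfl
  have e2 : ED D p (fun S => PrW D p B * (1 - ind A S)) = PrW D p B * (1 - PrW D p A) := by
    rw [ED_mul_left]
    congr 1
    have : ED D p (fun S => 1 - ind A S) = ED D p (fun _ => (1 : ℝ)) - ED D p (ind A) := CovTauStarN.ED_sub D p _ _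
    rw [this, PrW_eq_sum_ind]
    unfold ED
    simp only [mul_one]
    rw [sum_wtW D p]
  have e3 : ED D p (fun S => (1 - ind A S) * ind B S) = PrW D p B - PrW D p (A ∩ B) := by
    unfold ED
    rw [PrW_eq_sum_ind, PrW_eq_sum_ind, ← Finset.sum_sub_distrib]
    exact Finset.sum_congr rfl fun S _ => by rw [BHK2006.ind_inter]; ring
  rw [e1, e2, e3] at h
  nlinarith [h, PrW_nonneg D hp0 hp1 B]

end Harris

/-! ### Small set identities among the cells -/

section Sets

variable {a b c : V}

omit [Fintype V] [DecidableEq V] in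
/-- `conn` is symmetric. [folklore] -/
theorem conn_comm (u v : V) : (conn u v : Set (Finset (Sym2 V))) = conn v u :=
  Set.ext fun _ => ⟨fun h => SimpleGraph.Reachable.symm h, fun h => SimpleGraph.Reachable.symm h⟩

/-- `pivEv a b c` is a decreasing event. [this work] -/
theorem isLowerSet_pivEv (a b c : V) : IsLowerSet (pivEv a b c : Set (Finset (Sym2 V))) := by
  intro K K' hKK' hK hc
  exact hK (cl_mono (Finset.sdiff_subset_sdiff hKK' subset_rfl) b hc)

/-- If `a ≁ b`, then `b ~ c` iff `b ~ c` off the pairs at `a`. [this work] -/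
theorem mem_cl_sdiff_touch_iff_of_not_conn {K : Finset (Sym2 V)} (hK : K ∉ conn a b) :
    c ∈ cl (K \ touch {a}) b ↔ c ∈ cl K b := by
  refine ⟨fun h => cl_mono Finset.sdiff_subset b h, fun h => ?_⟩
  have hba : b ∉ cl K a := fun h' => hK (mem_conn_iff_mem_cl.2 h')
  have h1 := ThreePointGamma.cl_subset_cl_sdiff_touch hba h
  refine cl_mono (Finset.sdiff_subset_sdiff subset_rfl (touch_mono ?_)) b h1
  intro v hv
  rw [Finset.mem_singleton] at hv
  rw [hv]; exact mem_cl_self K a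

/-- `bc|a = {a apart} ∩ {b ~ c off a}`. [this work] -/
theorem Ua_eq : (conn b c ∩ (conn a b)ᶜ : Set (Finset (Sym2 V))) = ((conn a b)ᶜ ∩ (conn a c)ᶜ) ∩ (pivEv a b c)ᶜ := by
  ext K
  simp only [Set.mem_inter_iff, Set.mem_compl_iff, mem_pivEv, not_not]
  constructor
  · rintro ⟨hbc, hab⟩
    refine ⟨⟨hab, fun hac => hab ?_⟩, (mem_cl_sdiff_touch_iff_of_not_conn hab).2 (mem_conn_iff_mem_cl.1 hbc)⟩
    exact mem_conn.2 ((mem_conn.1 hac).trans (mem_conn.1 hbc).symm)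
  · rintro ⟨⟨hab, -⟩, h⟩
    exact ⟨mem_conn_iff_mem_cl.2 ((mem_cl_sdiff_touch_iff_of_not_conn hab).1 h), hab⟩

/-- `{b ~ c off a} ∩ {a ~ b} = abc ∩ {b ~ c off a}`. [this work] -/
theorem compl_pivEv_inter_conn :
    ((pivEv a b c)ᶜ ∩ conn a b : Set (Finset (Sym2 V))) = conn a b ∩ conn a c ∩ (pivEv a b c)ᶜ := by
  ext K
  simp only [Set.mem_inter_iff, Set.mem_compl_iff, mem_pivEv, not_not]
  constructor
  · rintro ⟨h, hab⟩
    refine ⟨⟨hab, ?_⟩, h⟩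
    have hbc : c ∈ cl K b := cl_mono Finset.sdiff_subset b h
    exact mem_conn.2 ((mem_conn.1 hab).trans (mem_cl.1 hbc))
  · rintro ⟨⟨hab, -⟩, h⟩; exact ⟨h, hab⟩

end Sets

/-! ### THEOREM dR2 -/

section Main

variable (D : Finset (Sym2 V)) {p : Sym2 V → ℝ} (hp0 : ∀ e, 0 ≤ p e) (hp1 : ∀ e, p e ≤ 1) {a b c : V}
include hp0 hp1

/-- **THEOREM dR2 (dual of the refined row R2).**  On the coordinates `D` with weights `p ∈ [0,1]`, for pairwise distinct `a, b, c`: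
`u_a · T_a + q · (T_a + T_b + T_c) ≤ q · t`, where `T_x = P(all joined ∧ x pivotal)`; equivalently `u_a · T_a ≤ q · T₀` with
`T₀ = t − T_a − T_b − T_c`.  Harris + `PivotalBHK.bhkRow_PrW` at `b` and at `c`. [this work] -/
theorem dualRowR2_PrW (hab : a ≠ b) (hac : a ≠ c) (hbc : b ≠ c) :
    PrW D p (conn b c ∩ (conn a b)ᶜ) * PrW D p (conn a b ∩ conn a c ∩ pivEv a b c) +
      PrW D p ((conn a b)ᶜ ∩ (conn a c)ᶜ ∩ (conn b c)ᶜ) *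
        (PrW D p (conn a b ∩ conn a c ∩ pivEv a b c) + PrW D p (conn b a ∩ conn b c ∩ pivEv b a c) +
          PrW D p (conn c a ∩ conn c b ∩ pivEv c a b)) ≤
      PrW D p ((conn a b)ᶜ ∩ (conn a c)ᶜ ∩ (conn b c)ᶜ) * PrW D p (conn a b ∩ conn a c) := by
  have hba : b ≠ a := fun h => hab h.symm
  have hca : c ≠ a := fun h => hac h.symm
  have hcb : c ≠ b := fun h => hbc h.symm
  -- the BHK rows at `b` and at `c`, with their cells renamed
  have hB := bhkRow_PrW hp0 hp1 D (a := b) (b := a) (c := c) hba hbc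
  have hC := bhkRow_PrW hp0 hp1 D (a := c) (b := a) (c := b) hca hcb
  have sQb : ((conn b a)ᶜ ∩ (conn b c)ᶜ ∩ (conn a c)ᶜ : Set (Finset (Sym2 V))) = (conn a b)ᶜ ∩ (conn a c)ᶜ ∩ (conn b c)ᶜ := by
    rw [conn_comm b a]; ext K; simp only [Set.mem_inter_iff, Set.mem_compl_iff]; tauto
  have sQc : ((conn c a)ᶜ ∩ (conn c b)ᶜ ∩ (conn a b)ᶜ : Set (Finset (Sym2 V))) = (conn a b)ᶜ ∩ (conn a c)ᶜ ∩ (conn b c)ᶜ := by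
    rw [conn_comm c a, conn_comm c b]; ext K; simp only [Set.mem_inter_iff, Set.mem_compl_iff]; tauto
  have sUa : (conn b c ∩ (conn b a)ᶜ : Set (Finset (Sym2 V))) = conn b c ∩ (conn a b)ᶜ := by rw [conn_comm b a]
  have sUa' : (conn c b ∩ (conn c a)ᶜ : Set (Finset (Sym2 V))) = conn b c ∩ (conn a b)ᶜ := by
    rw [conn_comm c b, conn_comm c a]
    ext K
    simp only [Set.mem_inter_iff, Set.mem_compl_iff]
    constructor
    · rintro ⟨hbc', hac'⟩; exact ⟨hbc', fun hab' => hac' (mem_conn.2 ((mem_conn.1 hab').trans (mem_conn.1 hbc')))⟩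
    · rintro ⟨hbc', hab'⟩; exact ⟨hbc', fun hac' => hab' (mem_conn.2 ((mem_conn.1 hac').trans (mem_conn.1 hbc').symm))⟩
  have sUc : (conn b a ∩ (conn b c)ᶜ : Set (Finset (Sym2 V))) = conn a b ∩ (conn a c)ᶜ := by
    rw [conn_comm b a]
    ext K
    simp only [Set.mem_inter_iff, Set.mem_compl_iff]
    constructor
    · rintro ⟨hab', hbc'⟩; exact ⟨hab', fun hac' => hbc' (mem_conn.2 ((mem_conn.1 hab').symm.trans (mem_conn.1 hac')))⟩
    · rintro ⟨hab', hac'⟩; exact ⟨hab', fun hbc' => hac' (mem_conn.2 ((mem_conn.1 hab').trans (mem_conn.1 hbc')))⟩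
  have sUb : (conn c a ∩ (conn c b)ᶜ : Set (Finset (Sym2 V))) = conn a c ∩ (conn a b)ᶜ := by
    rw [conn_comm c a, conn_comm c b]
    ext K
    simp only [Set.mem_inter_iff, Set.mem_compl_iff]
    constructor
    · rintro ⟨hac', hbc'⟩; exact ⟨hac', fun hab' => hbc' (mem_conn.2 ((mem_conn.1 hab').symm.trans (mem_conn.1 hac')))⟩
    · rintro ⟨hac', hab'⟩; exact ⟨hac', fun hbc' => hab' (mem_conn.2 ((mem_conn.1 hac').trans (mem_conn.1 hbc').symm))⟩
  rw [sQb, sUa, sUc] at hB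
  rw [sQc, sUa', sUb] at hC
  -- Harris for `{a apart}` (decreasing) and `{b ~ c off a}` (increasing)
  have hlow : IsLowerSet ((conn a b)ᶜ ∩ (conn a c)ᶜ : Set (Finset (Sym2 V))) :=
    (isUpperSet_conn a b).compl.inter (isUpperSet_conn a c).compl
  have hup : IsUpperSet ((pivEv a b c)ᶜ : Set (Finset (Sym2 V))) := (isLowerSet_pivEv a b c).compl
  have hH := PrW_inter_le_of_lower_upper D hp0 hp1 hlow hup
  rw [← Ua_eq] at hH
  -- masses of `{a apart}` and `{b ~ c off a}`
  have dj1 : Disjoint ((conn a b)ᶜ ∩ (conn a c)ᶜ ∩ (conn b c)ᶜ : Set (Finset (Sym2 V))) (conn b c ∩ (conn a b)ᶜ) :=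
    Set.disjoint_left.2 fun K h1 h2 => h1.2 h2.1
  have eA : ((conn a b)ᶜ ∩ (conn a c)ᶜ : Set (Finset (Sym2 V))) =
      ((conn a b)ᶜ ∩ (conn a c)ᶜ ∩ (conn b c)ᶜ) ∪ (conn b c ∩ (conn a b)ᶜ) := by
    ext K
    simp only [Set.mem_inter_iff, Set.mem_compl_iff, Set.mem_union]
    constructor
    · rintro ⟨h1, h2⟩
      by_cases h3 : K ∈ conn b c
      · exact Or.inr ⟨h3, h1⟩
      · exact Or.inl ⟨⟨h1, h2⟩, h3⟩
    · rintro (⟨⟨h1, h2⟩, -⟩ | ⟨h3, h1⟩)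
      · exact ⟨h1, h2⟩
      · exact ⟨h1, fun h2 => h1 (mem_conn.2 ((mem_conn.1 h2).trans (mem_conn.1 h3).symm))⟩
  have mA : PrW D p ((conn a b)ᶜ ∩ (conn a c)ᶜ) =
      PrW D p ((conn a b)ᶜ ∩ (conn a c)ᶜ ∩ (conn b c)ᶜ) + PrW D p (conn b c ∩ (conn a b)ᶜ) := by
    have h := PrW_union D p dj1
    rw [← eA] at h
    exact h
  have dj2 : Disjoint (conn b c ∩ (conn a b)ᶜ : Set (Finset (Sym2 V))) (conn a b ∩ conn a c ∩ (pivEv a b c)ᶜ) :=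
    Set.disjoint_left.2 fun K h1 h2 => h1.2 h2.1.1
  have eB : ((pivEv a b c)ᶜ : Set (Finset (Sym2 V))) = (conn b c ∩ (conn a b)ᶜ) ∪ (conn a b ∩ conn a c ∩ (pivEv a b c)ᶜ) := by
    rw [← compl_pivEv_inter_conn, Ua_eq]
    ext K
    simp only [Set.mem_inter_iff, Set.mem_compl_iff, Set.mem_union]
    constructor
    · intro h
      by_cases h1 : K ∈ conn a b
      · exact Or.inr ⟨h, h1⟩
      · refine Or.inl ⟨⟨h1, fun h2 => h1 ?_⟩, h⟩
        have hbc' : c ∈ cl K b := cl_mono Finset.sdiff_subset b (not_not.1 (mt mem_pivEv.2 h))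
        exact mem_conn.2 ((mem_conn.1 h2).trans (mem_cl.1 hbc').symm)
    · rintro (⟨-, h⟩ | ⟨h, -⟩) <;> exact h
  have mB : PrW D p ((pivEv a b c)ᶜ) = PrW D p (conn b c ∩ (conn a b)ᶜ) + PrW D p (conn a b ∩ conn a c ∩ (pivEv a b c)ᶜ) := by
    have h := PrW_union D p dj2
    rw [← eB] at h
    exact h
  have dj3 : Disjoint (conn a b ∩ conn a c ∩ pivEv a b c : Set (Finset (Sym2 V))) (conn a b ∩ conn a c ∩ (pivEv a b c)ᶜ) :=
    Set.disjoint_left.2 fun K h1 h2 => h2.2 h1.2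
  have mT : PrW D p (conn a b ∩ conn a c) = PrW D p (conn a b ∩ conn a c ∩ pivEv a b c) + PrW D p (conn a b ∩ conn a c ∩ (pivEv a b c)ᶜ) := by
    rw [← PrW_union D p dj3, Set.inter_union_compl]
  -- the five cells sum to one
  have hsum := TerminalGluing.PrW_cells_sum_one D p (∅ : Finset (Sym2 V)) a b c
  rw [evQ_empty, evT_empty, evU₁_empty, evU₂_empty, evU₃_empty, ← Set.inter_assoc] at hsum
  rw [mA, mB] at hH
  have hq := PrW_nonneg D hp0 hp1 ((conn a b)ᶜ ∩ (conn a c)ᶜ ∩ (conn b c)ᶜ)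
  have hua := PrW_nonneg D hp0 hp1 (conn b c ∩ (conn a b)ᶜ)
  nlinarith [hB, hC, hH, hsum, mT, hq, hua]

end Main

end PivotalBHK

end Summit.CriticalPhenomena.PercolationContinuityZ3.Theorems

end
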